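import Mathlib.CategoryTheory.Groupoid.Discrete
import Mathlib.CategoryTheory.Discrete.Basic
import Literature.IUT.HodgeTheaters.FrobeniusEtalePictures
import HarnessLib

/-!
# Non-vacuity witness for the §3 interface (`HodgeTheaterModel`, `ThetaHodgeTheater`)

Referee-facing complement to `ThetaHodgeTheaters.lean` ([IUTchI] §3, Def. 3.6, Cor. 3.7–3.9
[claim: Mochizuki2012, status: disputed]): for ANY initial Θ-data `D` the interface
`HodgeTheaterModel D` is inhabited (by the trivial model: every kind of collection of data is the
one-object discrete groupoid), hence so are `ThetaHodgeTheater`, the Θ-link, the Frobenius- and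
étale-pictures. This certifies that the interface axioms are jointly consistent relative to
`InitialThetaData` (they prove nothing by contradiction); it says nothing about the intended model,
whose construction is Examples 3.2–3.5 over inputs absent from the tree.
-/

namespace Literature.IUT.HodgeTheaters

open CategoryTheory

universe u v w

namespace HodgeTheaterModel

variable {F : Type u} {K : Type v} {Fbar : Type w} [Field F] [NumberField F] [Field K]
  [NumberField K] [Algebra F K] [Field Fbar] [Algebra F Fbar] [Algebra K Fbar]
  {E : WeierstrassCurve F} [E.IsElliptic] {l : ℕ} {P : BadPlacePredicates K}

/-- The one-object discrete groupoid used for every kind of data in the trivial model.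
[claim: Mochizuki2012, status: disputed] -/
abbrev Pt : Type := Discrete PUnit.{1}

/-- Any two functors into the one-object discrete groupoid are isomorphic.
[claim: Mochizuki2012, status: disputed] -/
def ptIso {C : Type*} [Category C] (Φ Ψ : C ⥤ Pt) : Φ ≅ Ψ :=
  NatIso.ofComponents (fun X => eqToIso (by ext)) (fun _ => Subsingleton.elim _ _)

/-- The TRIVIAL model of the §3 interface over arbitrary initial Θ-data `D` (non-vacuity witness).
[claim: Mochizuki2012, status: disputed] -/
abbrev trivial (D : InitialThetaData F K Fbar E l P) : HodgeTheaterModel.{u, v, w, 0} D where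
  Loc := fun _ => Pt
  Fref := fun _ => ⟨⟨⟩⟩
  BaseFull := fun _ => Pt
  baseFullOf := fun _ => 𝟭 Pt
  Dash := fun _ => Pt
  dashOf := fun _ => 𝟭 Pt
  thetaOf := fun _ => 𝟭 Pt
  tautLoc := fun _ => Iso.refl _
  Base := fun _ => Pt
  base := fun _ => 𝟭 Pt
  dashOfBase := fun _ => 𝟭 Pt
  baseCompat := fun _ => Iso.refl _
  Units := fun _ => Pt
  units := fun _ => 𝟭 Pt
  Glob := Pt
  FmodRef := ⟨⟨⟩⟩
  component := fun _ => 𝟭 Pt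
  componentRef := fun _ => Iso.refl _
  thtOf := 𝟭 Pt
  tautGlob := Iso.refl _

/-- A Θ-Hodge theater over the trivial model (Def. 3.6 is inhabited for every `D`).
[claim: Mochizuki2012, status: disputed] -/
abbrev trivialTheater (D : InitialThetaData F K Fbar E l P) : ThetaHodgeTheater (trivial D) :=
  ThetaHodgeTheater.ref (trivial D)

/-- A Frobenius-picture over the trivial model (Cor. 3.8 is inhabited for every `D`); each of its
Θ-links is nonempty by `FrobeniusPicture.link_nonempty`. [claim: Mochizuki2012, status: disputed] -/
def trivialPicture (D : InitialThetaData F K Fbar E l P) : FrobeniusPicture (trivial D) :=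
  ⟨fun _ => trivialTheater D⟩

/-- In the trivial model the "[full]" claims of Cor. 3.7 (ii) hold (sanity check of the typing:
the statements are satisfiable) — PROVED. [claim: Mochizuki2012, status: disputed] -/
theorem trivial_thetaLinkBaseFull (D : InitialThetaData F K Fbar E l P) (v : D.V) :
    ThetaHodgeTheater.ThetaLinkBaseFull (trivialTheater D) (trivialTheater D) v := by
  ext h
  simp only [ThetaHodgeTheater.thetaLinkBase, Set.mem_setOf_eq, PolyIso.full, Set.mem_univ,
    iff_true]
  obtain ⟨φ, hφ⟩ := (trivialTheater D).thetaLink_nonempty (trivialTheater D)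
  exact ⟨φ, hφ, Iso.ext (Subsingleton.elim _ _)⟩

end HodgeTheaterModel

end Literature.IUT.HodgeTheaters
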